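/-
b2b-lace packet, ENUMERATION SHARD B gen 14 (unit `b2b-lace-enum2-g14`).  GAPS.md 'lean2 gen 14' item 4 (the Stage-1-TYPED record line
at the record cell `(13, 28)`), tranche (C).  ADDITIVE: `MeanFieldD11AppDDischargedRev7` (the record line at the input-level twin) and
`MeanFieldD11AppDStage1U` (the typed `U` line at the superseded `(12, 28)` cell) are kept, untouched.
-/
import Literature.Probability.FitznerVanDerHofstad2017.MeanFieldD11AppDDischargedRev7
import Literature.Probability.FitznerVanDerHofstad2017.MeanFieldD11Stage1TailsEvalU13
import HarnessLib

/-!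
# `d = 11`: the kernel App.-D line AT THE RECORD CELL `(13, 28)` with both Assumption-4.3 hypotheses at the TYPED Stage-1 `U`-twin record

CITATION HEADER (PLACEMENT v11). This module is part of a certified REPRODUCTION of:
R. Fitzner, R. van der Hofstad, *Mean-field behavior for nearest-neighbor percolation in d > 10*,
Electron. J. Probab. 22 (2017), no. 43, 1–65 [FvdH17] (notebook `Percolation.nb`, record run `ComputedSteps = 13`,
`MaxNumberOfSteps = 28`), and *Generalized approach to the non-backtracking lace expansion*, Probab. Theory Related Fields 169 (2017),
1041–1119 [NoBLE17] (arXiv:1506.07977, 1506.07969).  Reproduces: [NoBLE17] Prop. 4.5(ii) (App. D Steps 1–5) at `d = 11` for the record's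
input tables and its assembly with [NoBLE17] Prop. 2.11 / Thm. 2.10 and the hub tree's NoBLE→infrared→triangle→θ(p_c)=0 chain, with the
Stage-1 hypotheses stated at the typed cells.  Origin: build `lace`, seat enum2 (gen 14).

WHAT THIS MODULE DOES.  `MeanFieldD11AppDDischargedRev7` (lean2-g14) proves the `d = 11` sentence ON THE RECORD LINE — certificate
`nobleCertificate_d11_inputs_rev7` at `γ = gammaC7` (the record's `γ`), tables `bi7`/`bo7`, all of [NoBLE17] App. D discharged — with
the two (S2a) Assumption-4.3 hypotheses stated at the INPUT-LEVEL twin `inputsI7` / `inputsO7` (two-engine envelopes of the notebook's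
cell-44 outputs at `(13, 28)`).  Its scope note left the Stage-1-TYPED form of that line ("Assumption 4.3 at the typed record `inpMajQ …`")
at the superseded `(12, 28)` cells (`MeanFieldD11AppDStage1U`).  `MeanFieldD11Stage1Tabs13` (p194178) and `MeanFieldD11Stage1TailsEvalU13`
now type the Stage-1 `U`-twin record WITH TAILS at the record cell — tables `dataHi13`, `P13 = ⟨11,13,28⟩`, O12g `stateRec`, exact
Neumann inverses `SQrU13`/`SbQrU13` — and decide `inpMajQU13_hi_dom_o : (inpMajQ dataHi13 P13 stateRec .o SQrU13 SbQrU13).Dom inputsO7`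
and `inpMajQU13_hi_dom_iU : (inpMajQ dataHi13 P13 stateRec .i SQrU13 SbQrU13).Dom inputsI7U`, `inputsI7U` := `inputsI7` with twenty-eight
fields multiplied by `1 + δ_f` (the `U` twin EXCEEDS `inputsI7` at `i`, as it exceeded `inputsI` at `(12, 28)`; brackets in that module).
This module composes:
* §1 (S2a) TRANSPORT at the improvement point: Assumption 4.3 at `(11, p, S)` with the typed `U`-twin constants (tails included) implies
  it with `inputsO7` (`nobleAssumption43At_inputsO7_of_stage1FullU13`; kernel: `inpMajQU13_hi_dom_o`, `inputsO7_WF`,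
  `NobleAssumption43At.of_dom`).  THE REV-7 INPUT TWIN AT `o` ABSORBS THE DERIVABLE MULTIPLICITIES AT THE RECORD CELL.
* §2 the auxiliary initial record `inputsI7U`: `inputsI7.Dom inputsI7U`, signs, `NobleInputsWF 11`, (N1′)(N2)(N3)(N4) by `norm_num`;
  (S2a) transport at `p_I` to `inputsI7U` (`nobleAssumption43At_inputsI7U_of_stage1FullU13`).
* §3 **the rev-7 certificate SURVIVES the inflation**: `nobleCertificate_d11_inputsI7U : NobleNumericCertificate 11 cMuC cWeightsC gammaC7
  GammaC (β^corr(inputsI7U)) (β^corr(inputsO7)) bi7 bo7` — the three initial-point inequalities (`Admissible`, `f₁ ≤ γ₁`, `f₂ ≤ γ₂`)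
  re-evaluated by `norm_num` through the typed D65-corrected App.-D map at the INFLATED record, the other fields those of
  `nobleCertificate_d11_inputs_rev7`.  Same `γ = gammaC7`, same tables: no free parameter is introduced.
* §4 [NoBLE17] Prop. 4.5(ii) at `p_I` with `inputsI7U`, App. D discharged (`nobleSimplifiedFormAt_d11_i7U₅`), the two oracle binders of
  Prop. 2.11 with (S2a′) at the typed `U` cells (`nobleInitialInputsAt_d11_typedU13_discharged`,
  `nobleImprovementInputsAt_d11_typedU13_discharged`), and the `d = 11` sentence: `meanField_d11_typedU13_discharged`,
  `percolationContinuity_d11_typedU13_discharged`, `meanField_full_d11_typedU13_discharged : MeanField 11`; §5 the same with the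
  (S2b)-INIT binder replaced by the twelve F-IM table hypotheses (`MeanFieldD11InitTables.nobleWeightedDiagramBoundAt_bi7`).

REMAINING HYPOTHESES of `meanField_full_d11_typedU13_discharged_initTables` (ANALYTIC, NOT CITABLE as typed; no named fact is consumed
anywhere in this module): (S2a′) [NoBLE17] Assumption 4.3 for the percolation split WITH THE CONSTANTS COMPUTED BY THE TYPED STAGE-1
`U`-TWIN RECORD AT THE RECORD CELL — at `p_I` the point-`i` record `inpMajQ dataHi13 P13 stateRec .i SQrU13 SbQrU13`, and at every
`p ∈ (p_I, p_c)` under `f ≤ Γ` the point-`o` record ([FvdH17] §§3–5: that the coded Stage-1 cells bound their lattice quantities —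
V1(a), untyped; the cells themselves ARE typed); the twelve `JUpper`/`JLower` table hypotheses of [FvdH17] §5.2 at `p_I`; and (S2b) on the
window, [FvdH17] Prop. 2.2's weighted-diagram bounds `bo7`.  Everything else — the Stage-1 recipe from the certified SRW tables to the
sixty constants (both points, tails included), the NoBLE equations, Assumption 4.1, the regime, App. D Steps 1–5 on both sides, the
certificate at `γ = gammaC7`, the infrared bound, the triangle condition and the critical exponents — is a kernel theorem.
SCOPE (as `MeanFieldD11AppDStage1U`): the `U` cells are the cells AS CODED except that the four repulsive-polygon cells carry the
DERIVABLE multiplicities (a majorant of the coded record); nothing here asserts that a cell bounds its lattice quantity; `inputsI7U` is an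
auxiliary kernel device, not a record of [FvdH17].  No record file is touched.  No sentence about any dimension other than `d = 11`.

[cite: FitznerVanDerHofstad2017, Thm 1.1 / Cor. 1.3 (d = 11), §2.5–§2.7; notebook Percolation.nb cells 41–44 at (13, 28)]
[cite: FitznerVanDerHofstad2016NoBLE, Thm 2.10, Prop. 2.11, Prop. 4.5, Assumption 4.3, App. D (D.1)–(D.32) pp. 1110–1118]
-/

noncomputable section

namespace Literature.Probability.FitznerVanDerHofstad2017

open _root_.MeasureTheory _root_.Filter _root_.Topology Literature.Probability.LatticeModels
open Literature.Barriers.CriticalPhenomena Literature.Probability.Percolation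
open scoped BigOperators

namespace D11

open D11FimSup
open NoGoFrame Stage1Cells Stage1Cells.CertD11RecU13
open Stage1Cells.CertD11CS13 (P13 dataHi13)
open Stage1Cells.CertD11Rec (stateRec)
open Stage1Tails.Rec.U (inpMajQ)

/-! ## 1. Improvement point: (S2a′) at the typed `U` twin of the record cell transports to `inputsO7` -/

/-- **(S2a) transport, improvement point, the `(13, 28)` `U`-twin record WITH TAILS.**  Assumption 4.3 at `(11, p, S)` with the constants
computed by the typed Stage-1 recipe over the derivable-multiplicity polygons (tails included, exact Neumann inverses `SQrU13`, `SbQrU13`)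
from the `(13, 28)` tables at the O12g state implies Assumption 4.3 with the rev-7 input twin `inputsO7` (kernel: `inpMajQU13_hi_dom_o`,
`inputsO7_WF`, `NobleAssumption43At.of_dom`). [cite: FitznerVanDerHofstad2016NoBLE, Assumption 4.3 pp. 1086–1088] [cite: FitznerVanDerHofstad2017, §2.5; notebook Percolation.nb cells 41–44 at (13, 28)] -/
theorem nobleAssumption43At_inputsO7_of_stage1FullU13 {p : unitInterval} {S : NobleSplit 11 p}
    (h : NobleAssumption43At 11 p S (inpMajQ dataHi13 P13 stateRec .o SQrU13 SbQrU13)) : NobleAssumption43At 11 p S inputsO7 :=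
  h.of_dom inpMajQU13_hi_dom_o inputsO7_WF.1

/-! ## 2. Initial point: the auxiliary record `inputsI7U` -/

set_option maxHeartbeats 4000000 in
/-- `inputsI7U` is dominated by (is weaker than) the rev-7 input twin `inputsI7`: thirty-two fields equal, twenty-eight larger. [cite: FitznerVanDerHofstad2016NoBLE, Assumption 4.3 pp. 1086–1088 (information order)] -/
theorem inputsI7_dom_inputsI7U : inputsI7.Dom inputsI7U where
  mu := le_rfl
  muMin := le_rfl
  mubOverMu := le_rfl
  mub := le_rfl
  xiAlphaOneMinusZeroAtZero := le_rfl
  xiAlphaZeroMinusOneAtZero := le_rfl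
  xiAlphaOneMinusZeroAtEi := le_rfl
  xiAlphaZeroMinusOneAtEi := le_rfl
  xiIotaAlphaIAtEi := le_rfl
  xiIotaAlphaIIAtZero := le_rfl
  xiIotaAlphaISumAroundEi := le_rfl
  xiIotaAlphaIISumAroundZero := le_rfl
  psiAlphaIOneMinusZeroAroundEi := le_rfl
  psiAlphaIIZeroMinusOneAroundZero := le_rfl
  psiAlphaIZeroMinusOneAroundEi := le_rfl
  psiAlphaIIOneMinusZeroAroundZero := le_rfl
  piAlpha := le_rfl
  piAlphaLower := le_rfl
  piOneLower := le_rfl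
  psiZeroLower := le_rfl
  xiAbs := by norm_num [inputsI7U, inputsI7]
  xiOdd := by norm_num [inputsI7U, inputsI7]
  xiEven := by norm_num [inputsI7U, inputsI7]
  xiEvenTail := by norm_num [inputsI7U, inputsI7]
  xiOddTail := by norm_num [inputsI7U, inputsI7]
  xiR0 := le_rfl
  xiR1 := by norm_num [inputsI7U, inputsI7]
  xiR0Delta := le_rfl
  xiR1Delta := by norm_num [inputsI7U, inputsI7]
  xiDeltaAbs := by norm_num [inputsI7U, inputsI7]
  xiOddDelta := by norm_num [inputsI7U, inputsI7]
  xiEvenDelta := by norm_num [inputsI7U, inputsI7]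
  xiOddTailDelta := by norm_num [inputsI7U, inputsI7]
  xiEvenTailDelta := by norm_num [inputsI7U, inputsI7]
  psiRI0 := le_rfl
  psiRI1 := by norm_num [inputsI7U, inputsI7]
  psiRII0 := le_rfl
  psiRII1 := by norm_num [inputsI7U, inputsI7]
  psiRI0Delta := le_rfl
  psiRI1Delta := by norm_num [inputsI7U, inputsI7]
  psiRII0Delta := le_rfl
  psiRII1Delta := by norm_num [inputsI7U, inputsI7]
  piR0 := le_rfl
  piR0DeltaEiEk := le_rfl
  xiIotaAbs := by norm_num [inputsI7U, inputsI7]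
  xiIotaOdd := by norm_num [inputsI7U, inputsI7]
  xiIotaEven := by norm_num [inputsI7U, inputsI7]
  xiIotaEvenTail := by norm_num [inputsI7U, inputsI7]
  xiIotaRI0 := le_rfl
  xiIotaRII0 := le_rfl
  xiIotaDeltaEi := by norm_num [inputsI7U, inputsI7]
  xiIotaOddDeltaEi := by norm_num [inputsI7U, inputsI7]
  xiIotaEvenDeltaEi := by norm_num [inputsI7U, inputsI7]
  xiIotaEvenTailDeltaEi := by norm_num [inputsI7U, inputsI7]
  xiIotaDeltaZero := by norm_num [inputsI7U, inputsI7]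
  xiIotaOddDeltaZero := by norm_num [inputsI7U, inputsI7]
  xiIotaEvenDeltaZero := by norm_num [inputsI7U, inputsI7]
  xiIotaEvenTailDeltaZero := by norm_num [inputsI7U, inputsI7]
  xiIotaRI0DeltaEi := le_rfl
  xiIotaRII0DeltaZero := le_rfl

set_option maxHeartbeats 4000000 in
/-- sign facts of `inputsI7U`. [cite: FitznerVanDerHofstad2016NoBLE, Assumption 4.3, "β^{(N)}_• ≥ 0" (p. 1086)] -/
theorem inputsI7U_nonneg : BetaMap.Inputs.Nonneg inputsI7U := by
  constructor <;> norm_num [inputsI7U, inputsI7]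

set_option maxHeartbeats 4000000 in
/-- `inputsI7U` is well formed (`NobleInputsWF 11`): signs, `0 ≤ μ < 1`, `0 ≤ β̲_μ`, the geometric ratio `2d·μ̄/(1−μ)·β^abs_{Ξ^ι} < 1`
(the inflated `xiIotaAbs` moves it from `0.00377…` by the factor `1 + 10⁻³`), `β_μ ≥ 1`, `β̲_μ > 0`. [cite: FitznerVanDerHofstad2016NoBLE, Assumption 4.3 (4.30) p. 1086; App. D (D.21), (D.29), (D.32)] -/
theorem inputsI7U_WF : NobleInputsWF 11 inputsI7U :=
  ⟨⟨inputsI7U_nonneg, by norm_num [inputsI7U, inputsI7], by norm_num [inputsI7U, inputsI7], by norm_num [inputsI7U, inputsI7],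
      by norm_num [inputsI7U, inputsI7]⟩, by norm_num [inputsI7U, inputsI7], by norm_num [inputsI7U, inputsI7]⟩

/-- **(S2a) transport, initial point, the `(13, 28)` `U`-twin record WITH TAILS, to the auxiliary record `inputsI7U`** (kernel:
`inpMajQU13_hi_dom_iU`). [cite: FitznerVanDerHofstad2016NoBLE, Assumption 4.3 pp. 1086–1088 (z = z_I)] [cite: FitznerVanDerHofstad2017, §2.4–§2.5; notebook Percolation.nb cells 41–44 at (13, 28)] -/
theorem nobleAssumption43At_inputsI7U_of_stage1FullU13 {p : unitInterval} {S : NobleSplit 11 p}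
    (h : NobleAssumption43At 11 p S (inpMajQ dataHi13 P13 stateRec .i SQrU13 SbQrU13)) : NobleAssumption43At 11 p S inputsI7U :=
  h.of_dom inpMajQU13_hi_dom_iU inputsI7U_WF.1

/-- Assumption 4.3 with the rev-7 initial-point twin `inputsI7` also implies it with `inputsI7U` (`inputsI7_dom_inputsI7U`). [cite: FitznerVanDerHofstad2016NoBLE, Assumption 4.3 pp. 1086–1088 (z = z_I)] -/
theorem nobleAssumption43At_inputsI7U_of_inputsI7 {p : unitInterval} {S : NobleSplit 11 p}
    (h : NobleAssumption43At 11 p S inputsI7) : NobleAssumption43At 11 p S inputsI7U :=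
  h.of_dom inputsI7_dom_inputsI7U inputsI7U_WF.1

/-- (N1′) at `inputsI7U` (the fields entering `c_Φ^low` are those of `inputsI7`). [cite: FitznerVanDerHofstad2016NoBLE, App. D (D.2) (p. 1110)] -/
theorem n1_inputsI7U :
    0 ≤ BetaMap.betaCPhiLow ((11 : ℕ) : ℝ) inputsI7U.mu inputsI7U.xiAlphaOneMinusZeroAtZero inputsI7U.xiIotaAlphaIAtEi :=
  n1_inputsI7

set_option maxHeartbeats 4000000 in
/-- (N2) at `inputsI7U`: `β^abs_Ξ + β^abs_{Ξ^ι} < 1` with the two fields inflated by `1 + 1/300`, `1 + 10⁻³`. [cite: FitznerVanDerHofstad2016NoBLE, Assumption 4.3 (4.31), (4.49) (pp. 1086–1088)] -/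
theorem n2_inputsI7U : inputsI7U.xiAbs + inputsI7U.xiIotaAbs < 1 := by norm_num [inputsI7U, inputsI7]

set_option maxHeartbeats 4000000 in
/-- (N3) at `inputsI7U`: `β_Ψ̂ < 1` (reads the inflated `xiOdd`). [cite: FitznerVanDerHofstad2016NoBLE, App. D (D.5) (p. 1111)] -/
theorem n3_inputsI7U : (BetaMap.nobleBetaOfInputs ((11 : ℕ) : ℝ) inputsI7U).βΨ < 1 := by
  norm_num [BetaMap.nobleBetaOfInputs, BetaMap.betaPsiHatLower, inputsI7U, inputsI7]

/-- `α_F^low` does not read any inflated field (`muMin`, `mu`, `psiAlpha…`, `piAlpha` only). [cite: FitznerVanDerHofstad2016NoBLE, App. D Step 1 (D.3) (p. 1111)] -/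
theorem beta_inputsI7U_αFlow :
    (BetaMap.nobleBetaOfInputs ((11 : ℕ) : ℝ) inputsI7U).αFlow = (BetaMap.nobleBetaOfInputs ((11 : ℕ) : ℝ) inputsI7).αFlow := rfl

/-- (N4) at `inputsI7U` (= `n4_inputsI7`). [cite: FitznerVanDerHofstad2016NoBLE, App. D Step 1 (D.3) (p. 1111)] -/
theorem n4_inputsI7U : 0 ≤ (BetaMap.nobleBetaOfInputs ((11 : ℕ) : ℝ) inputsI7U).αFlow := by
  rw [beta_inputsI7U_αFlow]; exact n4_inputsI7

/-! ## 3. The rev-7 certificate survives the inflation -/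

set_option maxHeartbeats 4000000 in
/-- **`P(γ, Γ)` at `d = 11` for the tables `β^corr(inputsI7U)`, `β^corr(inputsO7)` with the RECORD's `γ = gammaC7`, `bi7`, `bo7`**:
initial-point admissibility, `f₁`- and `f₂`-conditions re-evaluated by `norm_num` through the typed D65-corrected App.-D map at the
INFLATED record; window fields, `f₃`, `c_μ`, `c`, `γ < Γ` from `nobleCertificate_d11_inputs_rev7`.  `inputsI7U` is an auxiliary record,
so this is NOT a certificate of record; it shows the record's certificate has room for the `U`-twin excess at `i`.
[cite: FitznerVanDerHofstad2016NoBLE, Def. 2.9, Prop. 2.11] [cite: FitznerVanDerHofstad2017, §2.5–§2.7 and Figure 3 (d = 11)] -/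
theorem nobleCertificate_d11_inputsI7U :
    NobleNumericCertificate 11 cMuC cWeightsC gammaC7 GammaC (BetaMap.nobleBetaOfInputsCorr 11 inputsI7U)
      (BetaMap.nobleBetaOfInputsCorr 11 inputsO7) bi7 bo7 where
  one_lt_cμ := nobleCertificate_d11_inputs_rev7.one_lt_cμ
  c_pos := nobleCertificate_d11_inputs_rev7.c_pos
  γ_lt_Γ := nobleCertificate_d11_inputs_rev7.γ_lt_Γ
  admissible_init := by norm_num [NobleBeta.Admissible, inputsI7U, inputsI7, BetaMap.nobleBetaOfInputsCorr, BetaMap.betaRfDeltaCorr, BetaMap.nobleBetaOfInputs, BetaMap.betaMubarOverMu, BetaMap.betaCPhiUp, BetaMap.betaAfLow, BetaMap.betaapI, BetaMap.betaapII, BetaMap.betaPiHat, BetaMap.betaPsiHatLower, BetaMap.betaRp, BetaMap.betaRfDeltaLower]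
  admissible := nobleCertificate_d11_inputs_rev7.admissible
  f1Bound_init_le := by norm_num [NobleBeta.f1Bound, inputsI7U, inputsI7, cMuC, gammaC7, max_def, BetaMap.nobleBetaOfInputsCorr, BetaMap.betaRfDeltaCorr, BetaMap.nobleBetaOfInputs, BetaMap.betaMubarOverMu, BetaMap.betaCPhiUp, BetaMap.betaAfLow, BetaMap.betaapI, BetaMap.betaapII, BetaMap.betaPiHat, BetaMap.betaPsiHatLower, BetaMap.betaRp, BetaMap.betaRfDeltaLower]
  f2Bound_init_le := by norm_num [NobleBeta.f2Bound, inputsI7U, inputsI7, gammaC7, max_def, BetaMap.nobleBetaOfInputsCorr, BetaMap.betaRfDeltaCorr, BetaMap.nobleBetaOfInputs, BetaMap.betaMubarOverMu, BetaMap.betaCPhiUp, BetaMap.betaAfLow, BetaMap.betaapI, BetaMap.betaapII, BetaMap.betaPiHat, BetaMap.betaPsiHatLower, BetaMap.betaRp, BetaMap.betaRfDeltaLower]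
  f3_init_le := nobleCertificate_d11_inputs_rev7.f3_init_le
  f1Bound_le := nobleCertificate_d11_inputs_rev7.f1Bound_le
  f2Bound_le := nobleCertificate_d11_inputs_rev7.f2Bound_le
  f3_le := nobleCertificate_d11_inputs_rev7.f3_le

/-! ## 4. Prop. 4.5(ii) at `p_I` with `inputsI7U`, the two binders with (S2a′) at the typed `U` cells, the `d = 11` sentence -/

/-- [NoBLE17] Prop. 4.5(ii) at `p_I = 1/21` with the auxiliary record `inputsI7U`, App. D DISCHARGED (table `β^corr(inputsI7U)`).
[cite: FitznerVanDerHofstad2016NoBLE, Prop. 4.5 (p. 1088); Assumption 4.3 (z = z_I); App. D] [cite: FitznerVanDerHofstad2017, §2.4–§2.5] -/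
theorem nobleSimplifiedFormAt_d11_i7U₅
    (h43 : NobleAssumption43At 11 (nbwThresholdI 11)
      (percolationNobleSplit 11 (nbwThresholdI 11) two_le_eleven (nbwThresholdI_lt_criticalProbI two_le_eleven)) inputsI7U) :
    NobleSimplifiedFormAt 11 (nbwThresholdI 11) (BetaMap.nobleBetaOfInputsCorr ((11 : ℕ) : ℝ) inputsI7U) :=
  have hp := nbwThresholdI_lt_criticalProbI two_le_eleven
  have hp0 : 0 < ((nbwThresholdI 11 : unitInterval) : ℝ) := nbwThresholdI_pos (by norm_num)
  nobleSimplifiedFormAt_percolation₅ two_le_eleven hp hp0 inputsI7U_WF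
    (percolationNobleEquationAt_of_summable two_le_eleven hp hp0 h43.xiAbs.2.1 fun ι => (h43.xiIotaAbs ι).2.1)
    h43 n1_inputsI7U n2_inputsI7U n3_inputsI7U n4_inputsI7U

/-- **Initial-step binder at `d = 11` from (S2a′) at the typed `U`-twin cell of the record cell (point `i`, tails) and (S2b) `bi7`,
App. D discharged** (transport `U cell ≤ inputsI7U`: `nobleAssumption43At_inputsI7U_of_stage1FullU13`). [cite: FitznerVanDerHofstad2016NoBLE, Prop. 4.5, Prop. 2.11] [cite: FitznerVanDerHofstad2017, Prop. 2.2; §2.4–§2.5] -/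
theorem nobleInitialInputsAt_d11_typedU13_discharged
    (hI43 : NobleAssumption43At 11 (nbwThresholdI 11)
      (percolationNobleSplit 11 (nbwThresholdI 11) two_le_eleven (nbwThresholdI_lt_criticalProbI two_le_eleven))
      (inpMajQ dataHi13 P13 stateRec .i SQrU13 SbQrU13))
    (hIW : NobleWeightedDiagramBoundAt 11 (nbwThresholdI 11) bi7) :
    NobleInitialInputsAt 11 (BetaMap.nobleBetaOfInputsCorr 11 inputsI7U) bi7 := by
  have hS := nobleSimplifiedFormAt_d11_i7U₅ (nobleAssumption43At_inputsI7U_of_stage1FullU13 hI43)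
  simp only [Nat.cast_ofNat] at hS
  exact ⟨hS, hIW⟩

/-- **Improvement-step binder at `d = 11` from (S2a′) at the typed `U`-twin cell of the record cell (point `o`, tails) and (S2b) `bo7`
on the window, App. D discharged** (transport `U cell ≤ inputsO7`: `nobleAssumption43At_inputsO7_of_stage1FullU13`). [cite: FitznerVanDerHofstad2016NoBLE, Prop. 4.5, Prop. 2.11] [cite: FitznerVanDerHofstad2017, Prop. 2.2; §2.5] -/
theorem nobleImprovementInputsAt_d11_typedU13_discharged
    (hS : ∀ (p : unitInterval) (hp : p ∈ Set.Ioo (nbwThresholdI 11) (criticalProbI 11)),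
      (∀ j, Literature.Barriers.CriticalPhenomena.nobleF 11 cMuC cWeightsC j p ≤ GammaC j) →
        NobleAssumption43At 11 p (percolationNobleSplit 11 p two_le_eleven hp.2) (inpMajQ dataHi13 P13 stateRec .o SQrU13 SbQrU13) ∧
        NobleWeightedDiagramBoundAt 11 p bo7) :
    NobleImprovementInputsAt 11 cMuC cWeightsC GammaC (BetaMap.nobleBetaOfInputsCorr 11 inputsO7) bo7 :=
  nobleImprovementInputsAt_d11_rev7_discharged fun p hp hΓ =>
    let ⟨h43, hW⟩ := hS p hp hΓ
    ⟨nobleAssumption43At_inputsO7_of_stage1FullU13 h43, hW⟩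

/-- **Mean-field behaviour at `d = 11` ON THE RECORD LINE (`γ = gammaC7`, `bi7`, `bo7`), App. D discharged, both Assumption-4.3
hypotheses at the TYPED `U`-twin Stage-1 cells of the record cell `(13, 28)` (derivable repulsive-polygon multiplicities, tails, the
`(13, 28)` SRW tables).**  REMAINING HYPOTHESES (ANALYTIC, NOT CITABLE as typed; no named fact): (S2a′) at `p_I` with the `U` cell at `i`;
(S2a′) on `(p_I, p_c)` under `f ≤ Γ` with the `U` cell at `o`; (S2b) [FvdH17] Prop. 2.2's `bi7`, `bo7`.  SCOPE: module docstring.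
[cite: FitznerVanDerHofstad2017, Thm 1.1 / Cor. 1.3 (d = 11)] [cite: FitznerVanDerHofstad2016NoBLE, Thm 2.10, Prop. 2.11, Prop. 4.5, App. D] -/
theorem meanField_d11_typedU13_discharged
    (hI43 : NobleAssumption43At 11 (nbwThresholdI 11)
      (percolationNobleSplit 11 (nbwThresholdI 11) two_le_eleven (nbwThresholdI_lt_criticalProbI two_le_eleven))
      (inpMajQ dataHi13 P13 stateRec .i SQrU13 SbQrU13))
    (hIW : NobleWeightedDiagramBoundAt 11 (nbwThresholdI 11) bi7)
    (hS : ∀ (p : unitInterval) (hp : p ∈ Set.Ioo (nbwThresholdI 11) (criticalProbI 11)),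
      (∀ j, Literature.Barriers.CriticalPhenomena.nobleF 11 cMuC cWeightsC j p ≤ GammaC j) →
        NobleAssumption43At 11 p (percolationNobleSplit 11 p two_le_eleven hp.2) (inpMajQ dataHi13 P13 stateRec .o SQrU13 SbQrU13) ∧
        NobleWeightedDiagramBoundAt 11 p bo7) :
    TriangleCondition 11 ∧ PercolationContinuity 11 ∧ BetaEqOneBoundedRatio 11 :=
  meanField_of_certificate (by norm_num) nobleCertificate_d11_inputsI7U (nobleInitialInputsAt_d11_typedU13_discharged hI43 hIW)
    (nobleImprovementInputsAt_d11_typedU13_discharged hS)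

/-- `θ(p_c) = 0` on `ℤ^11` (hypotheses as in `meanField_d11_typedU13_discharged`). [cite: FitznerVanDerHofstad2017, Cor. 1.3 (d = 11)] -/
theorem percolationContinuity_d11_typedU13_discharged
    (hI43 : NobleAssumption43At 11 (nbwThresholdI 11)
      (percolationNobleSplit 11 (nbwThresholdI 11) two_le_eleven (nbwThresholdI_lt_criticalProbI two_le_eleven))
      (inpMajQ dataHi13 P13 stateRec .i SQrU13 SbQrU13))
    (hIW : NobleWeightedDiagramBoundAt 11 (nbwThresholdI 11) bi7)
    (hS : ∀ (p : unitInterval) (hp : p ∈ Set.Ioo (nbwThresholdI 11) (criticalProbI 11)),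
      (∀ j, Literature.Barriers.CriticalPhenomena.nobleF 11 cMuC cWeightsC j p ≤ GammaC j) →
        NobleAssumption43At 11 p (percolationNobleSplit 11 p two_le_eleven hp.2) (inpMajQ dataHi13 P13 stateRec .o SQrU13 SbQrU13) ∧
        NobleWeightedDiagramBoundAt 11 p bo7) :
    PercolationContinuity 11 :=
  (meanField_d11_typedU13_discharged hI43 hIW hS).2.1

/-- **[FvdH17] Cor. 1.3 at `d = 11` in full (`MeanField 11`) ON THE RECORD LINE — App. D discharged, (S2a′) at the typed `U`-twin cells
of the record cell, (S2b)** (hypotheses and SCOPE as in `meanField_d11_typedU13_discharged`; exponents by `meanField_of_triangle`). [cite: FitznerVanDerHofstad2017, Cor. 1.3 (d = 11), EJP p. 6] -/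
theorem meanField_full_d11_typedU13_discharged
    (hI43 : NobleAssumption43At 11 (nbwThresholdI 11)
      (percolationNobleSplit 11 (nbwThresholdI 11) two_le_eleven (nbwThresholdI_lt_criticalProbI two_le_eleven))
      (inpMajQ dataHi13 P13 stateRec .i SQrU13 SbQrU13))
    (hIW : NobleWeightedDiagramBoundAt 11 (nbwThresholdI 11) bi7)
    (hS : ∀ (p : unitInterval) (hp : p ∈ Set.Ioo (nbwThresholdI 11) (criticalProbI 11)),
      (∀ j, Literature.Barriers.CriticalPhenomena.nobleF 11 cMuC cWeightsC j p ≤ GammaC j) →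
        NobleAssumption43At 11 p (percolationNobleSplit 11 p two_le_eleven hp.2) (inpMajQ dataHi13 P13 stateRec .o SQrU13 SbQrU13) ∧
        NobleWeightedDiagramBoundAt 11 p bo7) :
    MeanField 11 :=
  meanField_of_triangle (by norm_num) (meanField_d11_typedU13_discharged hI43 hIW hS).1

/-! ## 5. The same with the (S2b)-INIT binder replaced by the twelve F-IM table hypotheses (`MeanFieldD11InitTables`) -/

/-- **`MeanField 11` ON THE RECORD LINE, App. D discharged, (S2a′) at the typed `U` cells, (S2b) at `p_I` from the tables**:
`meanField_full_d11_typedU13_discharged` with `hIW` supplied by `nobleWeightedDiagramBoundAt_bi7` ([FvdH17] §5.2 integral-majorant tables →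
the six weighted diagrams `≤ bi7`).  REMAINING: `hI43` ((S2a′) at `p_I`, typed `U` cell at `i`), the twelve `JUpper`/`JLower` table
hypotheses (582 rows, certified two-engine OUTSIDE the kernel), `hS` ((S2a′) with the typed `U` cell at `o` and (S2b) `bo7` on the window).
[cite: FitznerVanDerHofstad2017, Cor. 1.3 (d = 11); §5.2; (2.23)] -/
theorem meanField_full_d11_typedU13_discharged_initTables
    (hI43 : NobleAssumption43At 11 (nbwThresholdI 11)
      (percolationNobleSplit 11 (nbwThresholdI 11) two_le_eleven (nbwThresholdI_lt_criticalProbI two_le_eleven))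
      (inpMajQ dataHi13 P13 stateRec .i SQrU13 SbQrU13))
    (hU20 : JUpper 11 2 0 1 6 U_m2l0) (hL20 : JLower 11 2 0 Lo_m2l0 nodes_m2l0)
    (hU30 : JUpper 11 3 0 1 6 U_m3l0) (hL30 : JLower 11 3 0 Lo_m3l0 nodes_m3l0)
    (hU31 : JUpper 11 3 1 1 6 U_m3l1) (hL31 : JLower 11 3 1 Lo_m3l1 nodes_m3l1)
    (hU32 : JUpper 11 3 2 1 6 U_m3l2) (hL32 : JLower 11 3 2 Lo_m3l2 nodes_m3l2)
    (hU33 : JUpper 11 3 3 1 6 U_m3l3) (hL33 : JLower 11 3 3 Lo_m3l3 nodes_m3l3)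
    (hU35 : JUpper 11 3 5 1 6 U_m3l5) (hL35 : JLower 11 3 5 Lo_m3l5 nodes_m3l5)
    (hS : ∀ (p : unitInterval) (hp : p ∈ Set.Ioo (nbwThresholdI 11) (criticalProbI 11)),
      (∀ j, Literature.Barriers.CriticalPhenomena.nobleF 11 cMuC cWeightsC j p ≤ GammaC j) →
        NobleAssumption43At 11 p (percolationNobleSplit 11 p two_le_eleven hp.2) (inpMajQ dataHi13 P13 stateRec .o SQrU13 SbQrU13) ∧
        NobleWeightedDiagramBoundAt 11 p bo7) :
    MeanField 11 :=
  meanField_full_d11_typedU13_discharged hI43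
    (nobleWeightedDiagramBoundAt_bi7 hU20 hL20 hU30 hL30 hU31 hL31 hU32 hL32 hU33 hL33 hU35 hL35) hS

/-- `θ(p_c) = 0` on `ℤ^11` ON THE RECORD LINE, App. D discharged, (S2a′) at the typed `U` cells, (S2b) at `p_I` from the tables
(hypotheses as in `meanField_full_d11_typedU13_discharged_initTables`). [cite: FitznerVanDerHofstad2017, Cor. 1.3 (d = 11)] -/
theorem percolationContinuity_d11_typedU13_discharged_initTables
    (hI43 : NobleAssumption43At 11 (nbwThresholdI 11)
      (percolationNobleSplit 11 (nbwThresholdI 11) two_le_eleven (nbwThresholdI_lt_criticalProbI two_le_eleven))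
      (inpMajQ dataHi13 P13 stateRec .i SQrU13 SbQrU13))
    (hU20 : JUpper 11 2 0 1 6 U_m2l0) (hL20 : JLower 11 2 0 Lo_m2l0 nodes_m2l0)
    (hU30 : JUpper 11 3 0 1 6 U_m3l0) (hL30 : JLower 11 3 0 Lo_m3l0 nodes_m3l0)
    (hU31 : JUpper 11 3 1 1 6 U_m3l1) (hL31 : JLower 11 3 1 Lo_m3l1 nodes_m3l1)
    (hU32 : JUpper 11 3 2 1 6 U_m3l2) (hL32 : JLower 11 3 2 Lo_m3l2 nodes_m3l2)
    (hU33 : JUpper 11 3 3 1 6 U_m3l3) (hL33 : JLower 11 3 3 Lo_m3l3 nodes_m3l3)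
    (hU35 : JUpper 11 3 5 1 6 U_m3l5) (hL35 : JLower 11 3 5 Lo_m3l5 nodes_m3l5)
    (hS : ∀ (p : unitInterval) (hp : p ∈ Set.Ioo (nbwThresholdI 11) (criticalProbI 11)),
      (∀ j, Literature.Barriers.CriticalPhenomena.nobleF 11 cMuC cWeightsC j p ≤ GammaC j) →
        NobleAssumption43At 11 p (percolationNobleSplit 11 p two_le_eleven hp.2) (inpMajQ dataHi13 P13 stateRec .o SQrU13 SbQrU13) ∧
        NobleWeightedDiagramBoundAt 11 p bo7) :
    PercolationContinuity 11 :=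
  (meanField_full_d11_typedU13_discharged_initTables hI43 hU20 hL20 hU30 hL30 hU31 hL31 hU32 hL32 hU33 hL33 hU35 hL35 hS).1

end D11

end Literature.Probability.FitznerVanDerHofstad2017

end
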